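import Summits.QuantumFields.YangMills.Theorems.UnitScaleTiltProp7NestedMeanBridge
import Summits.QuantumFields.YangMills.Theorems.UnitScaleTiltProp7SymAvgTwSGaugeDir
import Summits.QuantumFields.YangMills.Theorems.UnitScaleTiltProp7QTwSScalarSectorRegPr
import Literature.MathematicalPhysics.QuantumFieldTheory.Balaban1983to89.B7BlockAvgLog
import HarnessLib

/-!
# Route `UnitScaleTilt`, crux K1 child «MinimiserStabilityRegPr» (stmt-QuantumFields-19200), skeleton v10, stub `stub_existenceMinimalOrbit` (EX), route (α) —
# **THE (H-Z) ROW OF THE (P2-core) PLAN v2 FROM ONE DISPLAYED HYPOTHESIS: «EVERY `Ū₀`-PARALLEL COARSE SECTION LIFTS TO A `U₀`-PARALLEL FINE SECTION»**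
# (★w5-20520 g7 20:05:26Z «px20: hHZ-ALGEBRA GO ON CURRENCY»; ★ym3-torus-px10's `LOCATE-P2-CORE-v2-px10.md` §3 exit (ii); the `hHZ` slot of ✓p662623 `Prop7LandauTransversalityPairing.hP_of_poincareZ`∕
# `htest_of_rows` with the sector `Z` of ✓p663081 §5).

Cell `ym3-torus`, width seat `ym3-torus-px20` (gen 2).  THEOREMS ONLY (0 `def`, 0 `sorry`).  `--supports stmt-QuantumFields-19200 --as helper`, count-neutral.  YM₃ on T³ is a ladder
rung (R3), not the Clay problem; nothing here claims the stub, the crux, d = 4 or the mass gap.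

THE POINT.  `N_S(U₀) = ker (Q(U₀)∘D_{U₀})` and, by ✓`Prop7SymAvgTwSGaugeDir.QTwS_gaugeDir_of_avgSeq` ([Balaban1985BackgroundPropagators] (3.19)∕(3.115)), `Q(U₀)(D_{U₀}λ)` is the COARSE covariant
derivative (w.r.t. the averaged background `Ū₀ = Ū₀♭⁽ᵏ⁾`, `k = K − n`) of the nested covariant block mean `ns_k λ`.  So `λ ∈ N_S` iff `ns_k λ` is a `Ū₀`-PARALLEL coarse section — not
necessarily `0`.  The Poincaré row (ROW-B∕ROW-T) lives on `ker ns_k`; the gap is closed by subtracting from `λ` a `U₀`-parallel FINE section `λ₀` with `ns_k λ₀ = ns_k λ` (it has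
`D_{U₀}λ₀ = 0`, so the same `D_{U₀}`-image).  Such a `λ₀` exists iff the parallel coarse section `ns_k λ` LIFTS — the one displayed hypothesis `hLift` of this file (true at
`U₀ = 1`, for abelian `U₀`, and whenever `Ū₀` has irreducible holonomy; it fails exactly on px10's located stratum (c) «`U₀` irreducible, `Ū₀` reducible»).  The algebra that makes
this work is (Z2): AVERAGING PRESERVES PARALLEL SECTIONS — every loop holonomy at `x` commutes with `λ₀(x)`, hence so do its logarithm (✓`B7BlockAvgLog.commute_mlog_right`), the mean
and the exponential (Mathlib `Commute.exp_right`), so the (0.4) average `Ū = eml(loops)·U(straight)` ([Balaban1987RG1] (0.4)) again transports `λ₀` restricted to the block centres.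

WHAT IS PROVED (sorry-free, no definition; ns `…Theorems.Prop7NestedMeanParallelLift`; generic `P`, complete normed ℂ-algebra `𝔸` in §1–§3):
* §1 `conjR_holT_of_parallel` (a `V`-parallel section is transported into itself along every word), `commute_of_conjR_eq`, `conjR_eq_self_of_commute`, `commute_eml` (`X` commuting with
  every `W_i` commutes with `eml W`).
* §2 ★★`parallel_emlAvgU` (ONE LEVEL: `V`-parallel `λ` ⟹ `λ ∘ emb` is `Ū`-parallel for the unguarded (0.4) average `Ū = emlAvgU V`), ★★`parallel_emlIterU` (the tower: `λ ∘ embIter j` is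
  `Ū⁽ʲ⁾`-parallel).
* §3 `hsucc_of_parallel` (the averaging sequence of a parallel section is `j ↦ λ₀ ∘ embIter j`: every summand of the `meanCLM` recursion of ✓`QTwS_gaugeDir_of_avgSeq` vanishes),
  `hsucc_sub` (the recursion is linear: differences of averaging sequences are averaging sequences).
* §4 (T³ member) `toL2_symm_DL2_toL2S_eq` (the (3.3) stencil as `η⁻¹•(Ad_{U₀(b)}λ(b₊) − λ(b₋))`), `DL2_toL2S_eq_zero_of_parallel`, ★`topMean_parallel_of_mem_NS` (`toL2S λ ∈ N_S` ⟹ the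
  top mean of ANY averaging sequence of `λ` is `Ū₀`-parallel, at `U₀ ∈ 𝔘_k(ε₀)`, `10¹²L³ε₀ ≤ 1`), and ★★★`hHZ_of_parallelLift`: under `hLift`,
  `∀ λ, toL2S λ ∈ N_S → ∃ λ₁, toL2S λ₁ ∈ N_S ∧ (∃ ns, ns 0 = λ₁ ∧ hsucc ∧ ns (K − n) = 0) ∧ DL2 U₀ (toL2S λ₁) = DL2 U₀ (toL2S λ)` — ✓p662623's `hHZ` binder VERBATIM at ✓p663081's `Z`.
INHABITABILITY of `hLift` (№9 (3)): at `U₀ = 1` parallel = constant and the lift of `c` is the constant `c(y₀)`… more precisely every `Ū₀ = 1`-parallel `c` is constant on the connected coarse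
torus and lifts to the same constant; nothing else is displayed.
HONEST SCOPE.  Linear algebra and bookkeeping; no estimate; the sector decision (whether the crux displays `hLift`, adds an irreducibility side condition, or treats the reducible-`Ū₀`
stratum separately) is the planner's; no stub ∕ crux statement is advanced.

References: T. Bałaban, CMP 99 (1985) 389–434 [Balaban1985BackgroundPropagators] ((3.3) p.391, (3.19)–(3.21) pp.393–394, (3.114)–(3.115) p.418); CMP 98 (1985) 17–51 [Balaban1985Averaging]
((8)–(11) pp.18–19, (21) p.21, (97) p.32); CMP 109 (1987) 249–301 [Balaban1987RG1] ((0.4), (0.6) p.253); CMP 96 (1984) 223–250 [Balaban1984PropagatorsII] ((2.7)–(2.12) pp.224–225).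
-/

set_option autoImplicit false

noncomputable section

open scoped BigOperators Matrix.Norms.L2Operator

namespace Summit.QuantumFields.YangMills.Theorems.Prop7NestedMeanParallelLift

open NormedSpace
open Literature.MathematicalPhysics.QuantumFieldTheory.Balaban1983to89
open Finset
open T4Continuum BlockAveraging ExpMeanLog MatrixLog
open BlockAveraging (Idx)
open B7Prop1Explicit (U1 mem_U1 treeWord disp)
open B7Eq78Linearization (conjR conjR_apply conjR_sub)
open B8Ineq132 (norm_conjR conjR_conjR one_conjR conjR_sum)
open B10Eq27TorusAxialLog (holT holT_nil holT_cons_true holT_cons_false transl unitsField toUField)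
open B7TransferAnalyticMean (meanCLM meanCLM_apply)
open B7BlockAvgLog (commute_mlog_right)
open B15DeterminingSets (embIter)
open Summit.QuantumFields.YangMills.Theorems.Prop8Chart (emlAvgU emlIterU loopHolU coe_emlAvgU emlIterU_succ emlIterU_zero)

/-! ## §1 Parallel sections, transports, and commutation with `exp[mean log]` -/

section Parallel

variable {P : Params} {𝔸 : Type*} [NormedRing 𝔸] [NormedAlgebra ℂ 𝔸] [CompleteSpace 𝔸]

omit [NormedAlgebra ℂ 𝔸] [CompleteSpace 𝔸] in
/-- **A PARALLEL SECTION IS TRANSPORTED INTO ITSELF ALONG EVERY WORD**: if `Ad_{V(b)}λ(b₊) = λ(b₋)` for every bond, then `Ad_{V(Γ)}λ(end Γ) = λ(start Γ)` for every word `Γ`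
(induction on the word; a backward letter uses `Ad_{V(b)⁻¹}` of the bond relation). [cite: Balaban1985Averaging, (8)-(9) pp.18-19] -/
theorem conjR_holT_of_parallel {j : ℕ} (V : GaugeField P j 𝔸ˣ) (l : Site P j → 𝔸) (hpar : ∀ b : PBond P j, conjR (V b) (l b.tgt) = l b.src) :
    ∀ (w : List (Letter P.d)) (x : Site P j), conjR (holT V x w) (l (walkEnd x w)) = l x
  | [], x => by rw [holT_nil, one_conjR]; rfl
  | (μ, true) :: w, x => by
    rw [holT_cons_true, ← conjR_conjR]
    show conjR (V ⟨x, μ⟩) (conjR (holT V (x.shift μ) w) (l (walkEnd (x.shift μ) w))) = l x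
    rw [conjR_holT_of_parallel V l hpar w (x.shift μ)]
    exact hpar ⟨x, μ⟩
  | (μ, false) :: w, x => by
    rw [holT_cons_false, ← conjR_conjR]
    show conjR (V ⟨x.unshift μ, μ⟩)⁻¹ (conjR (holT V (x.unshift μ) w) (l (walkEnd (x.unshift μ) w))) = l x
    rw [conjR_holT_of_parallel V l hpar w (x.unshift μ)]
    have h := hpar ⟨x.unshift μ, μ⟩
    have ht : (⟨x.unshift μ, μ⟩ : PBond P j).tgt = x := B10StarCount.shift_unshift x μ
    rw [ht] at h
    rw [← h, conjR_conjR, inv_mul_cancel, one_conjR]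

omit [NormedAlgebra ℂ 𝔸] [CompleteSpace 𝔸] in
/-- `Ad_u X = X` ⟹ `X` commutes with `u`. [folklore] -/
theorem commute_of_conjR_eq {u : 𝔸ˣ} {X : 𝔸} (h : conjR u X = X) : Commute X (u : 𝔸) := by
  show X * (u : 𝔸) = (u : 𝔸) * X
  conv_lhs => rw [← h]
  rw [conjR_apply, Units.inv_mul_cancel_right]

omit [NormedAlgebra ℂ 𝔸] [CompleteSpace 𝔸] in
/-- `X` commutes with `u` ⟹ `Ad_u X = X`. [folklore] -/
theorem conjR_eq_self_of_commute {u : 𝔸ˣ} {X : 𝔸} (h : Commute X (u : 𝔸)) : conjR u X = X := by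
  rw [conjR_apply, ← h.eq, mul_assoc, Units.mul_inv, mul_one]

omit [CompleteSpace 𝔸] in
/-- **`X` COMMUTING WITH EVERY `W_i` COMMUTES WITH `eml W = exp(|I|⁻¹Σ_i log W_i)`** (the logarithmic series (21), the mean, and the exponential series all preserve the commutant).
[cite: Balaban1985Averaging, (21) p.21; Balaban1987RG1, (0.4) p.253] -/
theorem commute_eml {ι : Type*} [Fintype ι] {X : 𝔸} {W : ι → 𝔸} (h : ∀ i, Commute X (W i)) : Commute X (eml W) := by
  rw [eml_eq_exp]
  refine Commute.exp_right ?_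
  refine Commute.smul_right ?_ _
  exact Commute.sum_right _ _ _ fun i _ => commute_mlog_right (h i)

end Parallel

/-! ## §2 Averaging preserves parallel sections -/

section Averaging

variable {P : Params} {𝔸 : Type*} [NormedRing 𝔸] [NormedAlgebra ℂ 𝔸] [CompleteSpace 𝔸]

/-- ★★ **ONE LEVEL: THE UNGUARDED (0.4) AVERAGE TRANSPORTS A PARALLEL SECTION RESTRICTED TO THE BLOCK CENTRES** — `Ad_{Ū(c)}λ(emb c₊) = λ(emb c₋)` for `Ū = emlAvgU V`
(`Ū(c) = eml(loops at emb c₋)·V(straight)`; the straight part transports by §1, each closed loop fixes `λ(emb c₋)` by §1, hence so does `eml` of the loops by `commute_eml`).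
[cite: Balaban1987RG1, (0.4) p.253; Balaban1985Averaging, (11) p.19] -/
theorem parallel_emlAvgU {j : ℕ} (V : GaugeField P j 𝔸ˣ) (l : Site P j → 𝔸) (hpar : ∀ b : PBond P j, conjR (V b) (l b.tgt) = l b.src)
    (c : PBond P (j + 1)) : conjR (emlAvgU V c) (l (emb c.tgt)) = l (emb c.src) := by
  have hE : emlAvgU V c = (isUnit_eml (fun i : Idx P => ((loopHolU V c i : 𝔸ˣ) : 𝔸))).unit * holT V (emb c.src) (List.replicate P.L (c.dir, true)) := rfl
  rw [hE, ← conjR_conjR]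
  have hS : conjR (holT V (emb c.src) (List.replicate P.L (c.dir, true))) (l (emb c.tgt)) = l (emb c.src) := by
    have h1 := conjR_holT_of_parallel V l hpar (List.replicate P.L (c.dir, true)) (emb c.src)
    rw [walkEnd_replicate_L] at h1
    exact h1
  rw [hS]
  refine conjR_eq_self_of_commute ?_
  rw [IsUnit.unit_spec]
  refine commute_eml fun i => ?_
  have hloop := conjR_holT_of_parallel V l hpar (loopWord P.L c.dir (off i.1) i.2.1 i.2.2) (emb c.src)
  rw [walkEnd_eq_self_of_netDisp (fun ν => by rw [netDisp_loopWord, Int.cast_zero])] at hloop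
  exact commute_of_conjR_eq hloop

/-- ★★ **THE TOWER: `λ₀ ∘ embIter j` IS `Ū⁽ʲ⁾`-PARALLEL** for every `j`, if `λ₀` is `V`-parallel on the finest lattice (`Ū⁽ʲ⁺¹⁾ = emlAvgU Ū⁽ʲ⁾`, `embIter (j+1) = embIter j ∘ emb`; §2 one level at a
time). [cite: Balaban1987RG1, (0.4) and (0.11) p.253; Balaban1985Averaging, (11) p.19, (97) p.32] -/
theorem parallel_emlIterU (V : GaugeField P 0 𝔸ˣ) (l : Site P 0 → 𝔸) (hpar : ∀ b : PBond P 0, conjR (V b) (l b.tgt) = l b.src) :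
    ∀ (j : ℕ) (b : PBond P j), conjR (emlIterU j V b) (l (embIter j b.tgt)) = l (embIter j b.src)
  | 0, b => hpar b
  | j + 1, c => parallel_emlAvgU (emlIterU j V) (fun z => l (embIter j z)) (parallel_emlIterU V l hpar j) c

end Averaging

/-! ## §3 The averaging-sequence recursion: parallel sections and linearity -/

section Recursion

variable {P : Params} {𝔸 : Type*} [NormedRing 𝔸] [NormedAlgebra ℂ 𝔸] [CompleteSpace 𝔸]

/-- **THE AVERAGING SEQUENCE OF A PARALLEL SECTION IS `j ↦ λ₀ ∘ embIter j`**: every summand `λ₀(embIter j ŷ) − Ad_{Ū⁽ʲ⁾(Γ_{y,i})}λ₀(embIter j x_{y,i})` of the `meanCLM` recursion of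
✓`QTwS_gaugeDir_of_avgSeq` vanishes (§2 + §1 along the staircase, whose end is `x_{y,i} = transl ŷ (disp Γ_{y,i})`). [cite: Balaban1985Averaging, (97) p.32; Balaban1985BackgroundPropagators, (3.19) p.393] -/
theorem hsucc_of_parallel (V : GaugeField P 0 𝔸ˣ) (l₀ : Site P 0 → 𝔸) (hpar : ∀ b : PBond P 0, conjR (V b) (l₀ b.tgt) = l₀ b.src) (j : ℕ) (y : Site P (j + 1)) :
    l₀ (embIter (j + 1) y) = l₀ (embIter j (emb y)) - meanCLM (Idx P) 𝔸 fun i : Idx P =>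
      l₀ (embIter j (emb y)) - ((holT (emlIterU j V) (emb y) (stairWord i.2.1 (off i.1)) : 𝔸ˣ) : 𝔸) * l₀ (embIter j (transl (emb y) (disp (stairWord i.2.1 (off i.1))))) *
        (((holT (emlIterU j V) (emb y) (stairWord i.2.1 (off i.1)))⁻¹ : 𝔸ˣ) : 𝔸) := by
  have hzero : (fun i : Idx P => l₀ (embIter j (emb y)) - ((holT (emlIterU j V) (emb y) (stairWord i.2.1 (off i.1)) : 𝔸ˣ) : 𝔸) *
      l₀ (embIter j (transl (emb y) (disp (stairWord i.2.1 (off i.1))))) * (((holT (emlIterU j V) (emb y) (stairWord i.2.1 (off i.1)))⁻¹ : 𝔸ˣ) : 𝔸)) = 0 := by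
    funext i
    have h1 := conjR_holT_of_parallel (emlIterU j V) (fun z => l₀ (embIter j z)) (parallel_emlIterU V l₀ hpar j) (stairWord i.2.1 (off i.1)) (emb y)
    rw [BlockAveragingEMLLinearised.walkEnd_emb_stairWord_eq_blockSite, conjR_apply] at h1
    rw [Pi.zero_apply, Prop7FrameLevelOnto.transl_emb_disp_stairWord_eq_blockSite, h1, sub_self]
  rw [hzero, map_zero, sub_zero]
  rfl

omit [CompleteSpace 𝔸] in
/-- **LINEARITY OF THE RECURSION**: the difference of two averaging sequences (same transports) is an averaging sequence. [cite: Balaban1985BackgroundPropagators, (3.19) p.393] -/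
theorem hsucc_sub (T : (j : ℕ) → Site P (j + 1) → Idx P → 𝔸ˣ) (ns ns' : (j : ℕ) → Site P j → 𝔸)
    (hns : ∀ (j : ℕ) (y : Site P (j + 1)), ns (j + 1) y = ns j (emb y) - meanCLM (Idx P) 𝔸 fun i : Idx P =>
        ns j (emb y) - ((T j y i : 𝔸ˣ) : 𝔸) * ns j (transl (emb y) (disp (stairWord i.2.1 (off i.1)))) * (((T j y i)⁻¹ : 𝔸ˣ) : 𝔸))
    (hns' : ∀ (j : ℕ) (y : Site P (j + 1)), ns' (j + 1) y = ns' j (emb y) - meanCLM (Idx P) 𝔸 fun i : Idx P =>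
        ns' j (emb y) - ((T j y i : 𝔸ˣ) : 𝔸) * ns' j (transl (emb y) (disp (stairWord i.2.1 (off i.1)))) * (((T j y i)⁻¹ : 𝔸ˣ) : 𝔸))
    (j : ℕ) (y : Site P (j + 1)) :
    ns (j + 1) y - ns' (j + 1) y = (ns j (emb y) - ns' j (emb y)) - meanCLM (Idx P) 𝔸 fun i : Idx P =>
        (ns j (emb y) - ns' j (emb y)) - ((T j y i : 𝔸ˣ) : 𝔸) * (ns j (transl (emb y) (disp (stairWord i.2.1 (off i.1)))) - ns' j (transl (emb y) (disp (stairWord i.2.1 (off i.1))))) *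
          (((T j y i)⁻¹ : 𝔸ˣ) : 𝔸) := by
  have hfun : (fun i : Idx P => (ns j (emb y) - ns' j (emb y)) - ((T j y i : 𝔸ˣ) : 𝔸) *
        (ns j (transl (emb y) (disp (stairWord i.2.1 (off i.1)))) - ns' j (transl (emb y) (disp (stairWord i.2.1 (off i.1))))) * (((T j y i)⁻¹ : 𝔸ˣ) : 𝔸))
      = (fun i : Idx P => ns j (emb y) - ((T j y i : 𝔸ˣ) : 𝔸) * ns j (transl (emb y) (disp (stairWord i.2.1 (off i.1)))) * (((T j y i)⁻¹ : 𝔸ˣ) : 𝔸))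
        - (fun i : Idx P => ns' j (emb y) - ((T j y i : 𝔸ˣ) : 𝔸) * ns' j (transl (emb y) (disp (stairWord i.2.1 (off i.1)))) * (((T j y i)⁻¹ : 𝔸ˣ) : 𝔸)) := by
    funext i
    simp only [Pi.sub_apply, mul_sub, sub_mul]
    abel
  rw [hns, hns', hfun, map_sub]
  abel

end Recursion

/-! ## §4 At the T³ member: `N_S` forces a parallel top mean; the (H-Z) row from the lifting hypothesis -/

section T3

open Literature.MathematicalPhysics.QuantumFieldTheory.Balaban1983to89.T3ContinuumYM3Torus
open T3PrintedRegularMinimiser (RegPr)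
open T3PrintedRegularOrbits (sites_eq)
open T3LevelShift (bondShift)
open T3SectALandauChart (bgUnits eta eta_pos)
open Summit.QuantumFields.YangMills.Theorems.Prop7SectET3Transport (bondEquiv bgOfCfg val_bgOfCfg isUnitaryBg_bgOfCfg)
open Summit.QuantumFields.YangMills.Theorems.Prop7SectET3HilbertLetters (toL2 toL2S toL2B QL2 DL2 DL2_apply QL2_toL2)
open Summit.QuantumFields.YangMills.Theorems.Prop7SectET3GaugeProjector (NS mem_NS_iff)
open Summit.QuantumFields.YangMills.Theorems.Prop7SymAvgTwSym (QTwS logChartTwS differentiableAt_logChartTwS_of_regPr)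
open Summit.QuantumFields.YangMills.Theorems.Prop7SymAvgTwSGaugeDir (QTwS_gaugeDir_of_avgSeq)
open Summit.QuantumFields.YangMills.Theorems.Prop7NestedMeanPoincare (conjR_unitsField_toUField)

variable (F : T3Family) {n K : ℕ}

/-- **THE (3.3) STENCIL IN `Ad` LETTERS**: `D_{U₀}(toL2S λ)`, read back on the bonds, is `η⁻¹•(Ad_{U₀♭(b)}λ(b₊) − λ(b₋))`. [cite: Balaban1985BackgroundPropagators, (3.3) p.391] -/
theorem toL2_symm_DL2_toL2S_eq {c₀ : ℝ} [Fact (0 < c₀)] (U₀ : GaugeField (F.P K) 0 (Matrix.specialUnitaryGroup (Fin 2) ℂ)) (l : Site (F.P K) 0 → Matrix (Fin 2) (Fin 2) ℂ) :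
    (toL2 F K c₀).symm (DL2 F n K c₀ U₀ (toL2S F K c₀ l)) =
      fun b => (((eta F n K : ℝ) : ℂ)⁻¹) • (conjR (bgUnits F K U₀ b) (l b.tgt) - l b.src) := by
  funext b
  have hinv : ((((bgOfCfg F K U₀ (bondEquiv F K b))⁻¹ : (Matrix (Fin 2) (Fin 2) ℂ)ˣ) : Matrix (Fin 2) (Fin 2) ℂ)) =
      star (((U₀ b : Matrix.specialUnitaryGroup (Fin 2) ℂ) : Matrix (Fin 2) (Fin 2) ℂ)) := by
    rw [isUnitaryBg_bgOfCfg, val_bgOfCfg, Equiv.symm_apply_apply]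
  rw [DL2_apply, hinv]
  show _ = (((eta F n K : ℝ) : ℂ)⁻¹) • (conjR (unitsField (toUField U₀) b) (l b.tgt) - l b.src)
  rw [conjR_unitsField_toUField]

/-- **A `U₀`-PARALLEL FINE SECTION HAS `D_{U₀}(toL2S λ₀) = 0`.** [cite: Balaban1985BackgroundPropagators, (3.3) p.391, (3.21) p.394] -/
theorem DL2_toL2S_eq_zero_of_parallel {c₀ : ℝ} [Fact (0 < c₀)] (U₀ : GaugeField (F.P K) 0 (Matrix.specialUnitaryGroup (Fin 2) ℂ)) (l₀ : Site (F.P K) 0 → Matrix (Fin 2) (Fin 2) ℂ)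
    (hpar : ∀ b : PBond (F.P K) 0, conjR (bgUnits F K U₀ b) (l₀ b.tgt) = l₀ b.src) :
    DL2 F n K c₀ U₀ (toL2S F K c₀ l₀) = 0 := by
  have h : (toL2 F K c₀).symm (DL2 F n K c₀ U₀ (toL2S F K c₀ l₀)) = 0 := by
    rw [toL2_symm_DL2_toL2S_eq]
    funext b
    rw [hpar b, sub_self, smul_zero]
    rfl
  simpa using h

/-- ★ **`toL2S λ ∈ N_S(U₀)` FORCES A `Ū₀`-PARALLEL TOP MEAN**: for `U₀ ∈ 𝔘_k(ε₀)` (`10¹²L³ε₀ ≤ 1`) and ANY averaging sequence `ns` of `λ` (the `h0`∕`hsucc` of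
✓`QTwS_gaugeDir_of_avgSeq`), `λ ∈ N_S` implies `Ad_{Ū₀(e)} ns_{K−n}(e₊) = ns_{K−n}(e₋)` on every coarse bond `e` (`Ū₀ = emlIterU (K − n) U₀♭`): `Q(U₀)(D_{U₀}λ) = 0` read through
(3.19) in closed form, the (3.3) stencil, and the level identification `bondShift`. [cite: Balaban1985BackgroundPropagators, (3.19) p.393, (3.21) p.394, (3.115) p.418] -/
theorem topMean_parallel_of_mem_NS (h : n ≤ K) {c₀ : ℝ} [Fact (0 < c₀)] {cB : ℝ} {ε₀ : ℝ} (hε₀ : 0 < ε₀) (hWε : 10 ^ 12 * (F.L : ℝ) ^ 3 * ε₀ ≤ 1)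
    (U₀ : GaugeField (F.P K) 0 (Matrix.specialUnitaryGroup (Fin 2) ℂ)) (hreg : RegPr F n K ε₀ U₀)
    (ns : (j : ℕ) → Site (F.P K) j → Matrix (Fin 2) (Fin 2) ℂ) (l : Site (F.P K) 0 → Matrix (Fin 2) (Fin 2) ℂ) (h0 : ns 0 = l)
    (hsucc : ∀ (j : ℕ) (y : Site (F.P K) (j + 1)), ns (j + 1) y = ns j (emb y) - meanCLM (Idx (F.P K)) (Matrix (Fin 2) (Fin 2) ℂ) fun i : Idx (F.P K) =>
        ns j (emb y) - ((holT (emlIterU j (bgUnits F K U₀)) (emb y) (stairWord i.2.1 (off i.1)) : (Matrix (Fin 2) (Fin 2) ℂ)ˣ) : Matrix (Fin 2) (Fin 2) ℂ) *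
          ns j (transl (emb y) (disp (stairWord i.2.1 (off i.1)))) * (((holT (emlIterU j (bgUnits F K U₀)) (emb y) (stairWord i.2.1 (off i.1)))⁻¹ : (Matrix (Fin 2) (Fin 2) ℂ)ˣ) : Matrix (Fin 2) (Fin 2) ℂ))
    (hl : toL2S F K c₀ l ∈ NS F n K h c₀ cB U₀) (e : PBond (F.P K) (K - n)) :
    conjR (emlIterU (K - n) (bgUnits F K U₀) e) (ns (K - n) e.tgt) = ns (K - n) e.src := by
  have hS := differentiableAt_logChartTwS_of_regPr F h hε₀ hWε U₀ hreg
  have hQ := QTwS_gaugeDir_of_avgSeq F h U₀ hS l ns h0 hsucc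
  -- `N_S` membership: `QTwS` of the (3.3) stencil vanishes
  set G : PBond (F.P K) 0 → Matrix (Fin 2) (Fin 2) ℂ := (toL2 F K c₀).symm (DL2 F n K c₀ U₀ (toL2S F K c₀ l)) with hGdef
  have hG0 : QTwS F n K h U₀ G = 0 := by
    have h1 : QL2 F n K h c₀ cB U₀ (DL2 F n K c₀ U₀ (toL2S F K c₀ l)) = 0 := (mem_NS_iff U₀ _).1 hl
    have h2 : DL2 F n K c₀ U₀ (toL2S F K c₀ l) = toL2 F K c₀ G := by rw [hGdef, LinearEquiv.apply_symm_apply]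
    rw [h2, QL2_toL2] at h1
    exact (LinearEquiv.map_eq_zero_iff _).1 h1
  -- the gauge direction of `λ` is `−η•G`
  have hdir : (fun b : PBond (F.P K) 0 => l b.src - ((bgUnits F K U₀ b : (Matrix (Fin 2) (Fin 2) ℂ)ˣ) : Matrix (Fin 2) (Fin 2) ℂ) * l b.tgt *
      (((bgUnits F K U₀ b)⁻¹ : (Matrix (Fin 2) (Fin 2) ℂ)ˣ) : Matrix (Fin 2) (Fin 2) ℂ)) = (-((eta F n K : ℝ) : ℂ)) • G := by
    have hη : ((eta F n K : ℝ) : ℂ) ≠ 0 := by exact_mod_cast (eta_pos F n K).ne'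
    rw [hGdef, toL2_symm_DL2_toL2S_eq]
    funext b
    simp only [Pi.smul_apply, smul_smul, neg_mul, mul_inv_cancel₀ hη, neg_smul, one_smul, neg_sub, conjR_apply]
  have hzero : QTwS F n K h U₀ (fun b : PBond (F.P K) 0 => l b.src - ((bgUnits F K U₀ b : (Matrix (Fin 2) (Fin 2) ℂ)ˣ) : Matrix (Fin 2) (Fin 2) ℂ) * l b.tgt *
      (((bgUnits F K U₀ b)⁻¹ : (Matrix (Fin 2) (Fin 2) ℂ)ˣ) : Matrix (Fin 2) (Fin 2) ℂ)) = 0 := by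
    rw [hdir, map_smul, hG0, smul_zero]
  rw [hQ] at hzero
  -- read at the coarse bond `e = bondShift c`
  have hc := congrFun hzero ((bondShift (sites_eq F n K h)).symm e)
  simp only [Equiv.apply_symm_apply] at hc
  rw [conjR_apply]
  exact (sub_eq_zero.1 hc).symm

/-- ★★★ **THE (H-Z) ROW FROM THE LIFTING HYPOTHESIS.**  Let `U₀ ∈ 𝔘_k(ε₀)` (`RegPr`, `10¹²L³ε₀ ≤ 1`) and assume (`hLift`, DISPLAYED): every coarse section `c` on `T^{(K−n)}` that is
parallel for the averaged background `Ū₀ = emlIterU (K − n) U₀♭` is the restriction to the iterated block centres of a fine section `λ₀` parallel for `U₀♭`.  THEN for every gauge parameter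
`λ` with `toL2S λ ∈ N_S(U₀)` there is `λ₁` (namely `λ − λ₀`, `λ₀` the lift of the top mean of `λ`) with `toL2S λ₁ ∈ N_S(U₀)`, an averaging sequence of `λ₁` (the `hsucc` recursion of
✓`QTwS_gaugeDir_of_avgSeq`) VANISHING at level `K − n`, and the same `D_{U₀}`-image: `DL2 U₀ (toL2S λ₁) = DL2 U₀ (toL2S λ)` — the `hHZ` row of ✓`Prop7LandauTransversalityPairing.hP_of_poincareZ`∕`htest_of_rows`
at the sector `Z` of ✓`Prop7NestedMeanPoincare.hPoinc_of_towerCloseness`. [cite: Balaban1985BackgroundPropagators, (3.19)-(3.21) pp.393-394, (3.115) p.418; Balaban1985Averaging, (97) p.32; Balaban1987RG1, (0.4) p.253] -/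
theorem hHZ_of_parallelLift (h : n ≤ K) {c₀ : ℝ} [Fact (0 < c₀)] {cB : ℝ} {ε₀ : ℝ} (hε₀ : 0 < ε₀) (hWε : 10 ^ 12 * (F.L : ℝ) ^ 3 * ε₀ ≤ 1)
    (U₀ : GaugeField (F.P K) 0 (Matrix.specialUnitaryGroup (Fin 2) ℂ)) (hreg : RegPr F n K ε₀ U₀)
    (hLift : ∀ cf : Site (F.P K) (K - n) → Matrix (Fin 2) (Fin 2) ℂ,
      (∀ e : PBond (F.P K) (K - n), cf e.src = ((emlIterU (K - n) (bgUnits F K U₀) e : (Matrix (Fin 2) (Fin 2) ℂ)ˣ) : Matrix (Fin 2) (Fin 2) ℂ) * cf e.tgt *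
        (((emlIterU (K - n) (bgUnits F K U₀) e)⁻¹ : (Matrix (Fin 2) (Fin 2) ℂ)ˣ) : Matrix (Fin 2) (Fin 2) ℂ)) →
      ∃ l₀ : Site (F.P K) 0 → Matrix (Fin 2) (Fin 2) ℂ,
        (∀ b : PBond (F.P K) 0, l₀ b.src = ((bgUnits F K U₀ b : (Matrix (Fin 2) (Fin 2) ℂ)ˣ) : Matrix (Fin 2) (Fin 2) ℂ) * l₀ b.tgt * (((bgUnits F K U₀ b)⁻¹ : (Matrix (Fin 2) (Fin 2) ℂ)ˣ) : Matrix (Fin 2) (Fin 2) ℂ)) ∧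
        ∀ y : Site (F.P K) (K - n), l₀ (embIter (K - n) y) = cf y) :
    ∀ l : Site (F.P K) 0 → Matrix (Fin 2) (Fin 2) ℂ, toL2S F K c₀ l ∈ NS F n K h c₀ cB U₀ →
      ∃ l₁ : Site (F.P K) 0 → Matrix (Fin 2) (Fin 2) ℂ, toL2S F K c₀ l₁ ∈ NS F n K h c₀ cB U₀ ∧
        (∃ ns : (j : ℕ) → Site (F.P K) j → Matrix (Fin 2) (Fin 2) ℂ, ns 0 = l₁ ∧
          (∀ (j : ℕ) (y : Site (F.P K) (j + 1)), ns (j + 1) y = ns j (emb y) - meanCLM (Idx (F.P K)) (Matrix (Fin 2) (Fin 2) ℂ) fun i : Idx (F.P K) =>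
            ns j (emb y) - ((holT (emlIterU j (bgUnits F K U₀)) (emb y) (stairWord i.2.1 (off i.1)) : (Matrix (Fin 2) (Fin 2) ℂ)ˣ) : Matrix (Fin 2) (Fin 2) ℂ) *
              ns j (transl (emb y) (disp (stairWord i.2.1 (off i.1)))) * (((holT (emlIterU j (bgUnits F K U₀)) (emb y) (stairWord i.2.1 (off i.1)))⁻¹ : (Matrix (Fin 2) (Fin 2) ℂ)ˣ) : Matrix (Fin 2) (Fin 2) ℂ)) ∧
          ∀ y, ns (K - n) y = 0) ∧
        DL2 F n K c₀ U₀ (toL2S F K c₀ l₁) = DL2 F n K c₀ U₀ (toL2S F K c₀ l) := by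
  intro l hl
  -- the transports and the averaging sequence of `λ`
  set T : (j : ℕ) → Site (F.P K) (j + 1) → Idx (F.P K) → (Matrix (Fin 2) (Fin 2) ℂ)ˣ :=
    fun j y i => holT (emlIterU j (bgUnits F K U₀)) (emb y) (stairWord i.2.1 (off i.1)) with hTdef
  let ns : (j : ℕ) → Site (F.P K) j → Matrix (Fin 2) (Fin 2) ℂ := fun j =>
    Nat.rec (motive := fun j => Site (F.P K) j → Matrix (Fin 2) (Fin 2) ℂ) l
      (fun j nsj y => nsj (emb y) - meanCLM (Idx (F.P K)) (Matrix (Fin 2) (Fin 2) ℂ) fun i : Idx (F.P K) =>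
        nsj (emb y) - ((T j y i : (Matrix (Fin 2) (Fin 2) ℂ)ˣ) : Matrix (Fin 2) (Fin 2) ℂ) * nsj (transl (emb y) (disp (stairWord i.2.1 (off i.1)))) *
          (((T j y i)⁻¹ : (Matrix (Fin 2) (Fin 2) ℂ)ˣ) : Matrix (Fin 2) (Fin 2) ℂ)) j
  have h0 : ns 0 = l := rfl
  have hsucc : ∀ (j : ℕ) (y : Site (F.P K) (j + 1)), ns (j + 1) y = ns j (emb y) - meanCLM (Idx (F.P K)) (Matrix (Fin 2) (Fin 2) ℂ) fun i : Idx (F.P K) =>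
      ns j (emb y) - ((T j y i : (Matrix (Fin 2) (Fin 2) ℂ)ˣ) : Matrix (Fin 2) (Fin 2) ℂ) * ns j (transl (emb y) (disp (stairWord i.2.1 (off i.1)))) *
        (((T j y i)⁻¹ : (Matrix (Fin 2) (Fin 2) ℂ)ˣ) : Matrix (Fin 2) (Fin 2) ℂ) := fun _ _ => rfl
  -- the top mean is `Ū₀`-parallel, hence lifts
  have hparTop : ∀ e : PBond (F.P K) (K - n), ns (K - n) e.src = ((emlIterU (K - n) (bgUnits F K U₀) e : (Matrix (Fin 2) (Fin 2) ℂ)ˣ) : Matrix (Fin 2) (Fin 2) ℂ) *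
      ns (K - n) e.tgt * (((emlIterU (K - n) (bgUnits F K U₀) e)⁻¹ : (Matrix (Fin 2) (Fin 2) ℂ)ˣ) : Matrix (Fin 2) (Fin 2) ℂ) := fun e => by
    rw [← conjR_apply]; exact (topMean_parallel_of_mem_NS F h hε₀ hWε U₀ hreg ns l h0 hsucc hl e).symm
  obtain ⟨l₀, hpar₀, htop₀⟩ := hLift (ns (K - n)) hparTop
  have hpar₀' : ∀ b : PBond (F.P K) 0, conjR (bgUnits F K U₀ b) (l₀ b.tgt) = l₀ b.src := fun b => by rw [conjR_apply]; exact (hpar₀ b).symm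
  have hD₀ : DL2 F n K c₀ U₀ (toL2S F K c₀ l₀) = 0 := DL2_toL2S_eq_zero_of_parallel F U₀ l₀ hpar₀'
  have hl₀ : toL2S F K c₀ l₀ ∈ NS F n K h c₀ cB U₀ := by rw [mem_NS_iff, hD₀, map_zero]
  refine ⟨l - l₀, ?_, ⟨fun j z => ns j z - l₀ (embIter j z), rfl, ?_, ?_⟩, ?_⟩
  · rw [map_sub]; exact Submodule.sub_mem _ hl hl₀
  · intro j y
    exact hsucc_sub T ns (fun j z => l₀ (embIter j z)) hsucc (fun j y => hsucc_of_parallel (bgUnits F K U₀) l₀ hpar₀' j y) j y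
  · intro y
    show ns (K - n) y - l₀ (embIter (K - n) y) = 0
    rw [htop₀ y, sub_self]
  · rw [map_sub, map_sub, hD₀, sub_zero]

end T3

end Summit.QuantumFields.YangMills.Theorems.Prop7NestedMeanParallelLift

end
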